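import Mathlib
import HarnessLib

/-!
# Low-order Gauss–Laguerre, Radau–Laguerre and Gauss–Hermite rules in closed form
# (Davis–Rabinowitz 1984, Sect. 3.6 (3.6.3), (3.6.9), (3.6.11))

Davis–Rabinowitz, *Methods of Numerical Integration* (2nd ed., 1984), Sect. 3.6 "Gaussian formulas for the
infinite interval": the Laguerre formula `∫_0^∞ e^{-x} f = Σ w_k f(x_k) + (n!)²/(2n)! f^{(2n)}(ξ)` (3.6.3), the
Radau–Laguerre formula `∫_0^∞ e^{-x} f = (1/n) f(0) + Σ_{k<n} w_k f(x_k) + (n-1)! n!/(2n-1)! f^{(2n-1)}(ξ)`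
(3.6.9), and the Hermite formula `∫_{-∞}^{∞} e^{-x²} f = Σ w_k f(x_k) + n! √π/(2^n (2n)!) f^{(2n)}(ξ)` (3.6.11).

Recorded (self-contained, coefficientwise on `ℝ[X]`): the moments `∫_0^∞ x^k e^{-x} dx = k!` and
`∫ x^{2j} e^{-x²} dx = Γ(j + 1/2)`, `∫ x^{2j+1} e^{-x²} dx = 0`; the closed forms of the smallest rules —
Laguerre `GL₁` (node `1`, weight `1`), `GL₂` (nodes `2 ∓ s`, weights `(2 ± s)/4`, `s² = 2`), Radau–Laguerre
`RL₂` (nodes `0, 2`, weights `1/2, 1/2`), Hermite `GH₂` (nodes `±u`, `u² = 1/2`, weights `√π/2`) and `GH₃`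
(nodes `0, ±v`, `v² = 3/2`, weights `2√π/3, √π/6`) — with their exactness degrees `1, 3, 2, 3, 5` and the error
coefficients of (3.6.3)/(3.6.9)/(3.6.11) (`1/2, 1/6`; `1/3`; `√π/48, √π/960`) pinned on the first non-exact
degree.  The tree's `Literature.Probability.Distributions.GaussianMoments` records the probabilists' moments
`∫ x^{2r} e^{-x²/2} dx = √(2π) (2r-1)!!` (Janson 1997) — a different normalisation; nothing there is restated.

Provenance: engines group, shared numerical engines serving client cells; rigour lives in the verifiers; every
published number belongs to a client cell's ledger, not to the engines group.  Textbook facts only (no client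
numbers).
-/

namespace Literature.Analysis.Quadrature

open Set MeasureTheory Finset Polynomial Real
open scoped Real

noncomputable section

/-! ### Laguerre moments `∫_0^∞ x^k e^{-x} dx = k!` -/

/-- `x ↦ x^k e^{-x}` is integrable on `(0, ∞)`. [cite: DavisRabinowitz1984, Sect. 3.6 (3.6.3)] -/
theorem integrableOn_pow_mul_exp_neg (k : ℕ) :
    IntegrableOn (fun x : ℝ => x ^ k * exp (-x)) (Ioi 0) := by
  have h := Real.GammaIntegral_convergent (s := k + 1) (by positivity)
  refine (h.congr_fun (fun x hx => ?_) measurableSet_Ioi)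
  simp only [add_sub_cancel_right, Real.rpow_natCast, mul_comm]

/-- The Laguerre moments: `∫_0^∞ x^k e^{-x} dx = k!`. [cite: DavisRabinowitz1984, Sect. 3.6 (3.6.3)] -/
theorem integral_pow_mul_exp_neg_Ioi (k : ℕ) : ∫ x in Ioi (0 : ℝ), x ^ k * exp (-x) = k.factorial := by
  rw [← Real.Gamma_nat_eq_factorial, Real.Gamma_eq_integral (by positivity)]
  refine setIntegral_congr_fun measurableSet_Ioi fun x hx => ?_
  rw [add_sub_cancel_right, Real.rpow_natCast, mul_comm]

/-- `∫_0^∞ p(x) e^{-x} dx = Σ_{i<n} c_i · i!` for `deg p < n`. [cite: DavisRabinowitz1984, Sect. 3.6 (3.6.3)] -/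
theorem integral_eval_mul_exp_neg_Ioi (p : ℝ[X]) {n : ℕ} (hn : p.natDegree < n) :
    ∫ x in Ioi (0 : ℝ), p.eval x * exp (-x) = ∑ i ∈ range n, p.coeff i * (i.factorial : ℝ) := by
  simp_rw [eval_eq_sum_range' hn, Finset.sum_mul]
  rw [integral_finsetSum _ fun i _ => ?_]
  · refine Finset.sum_congr rfl fun i _ => ?_
    simp_rw [mul_assoc]
    rw [integral_const_mul, integral_pow_mul_exp_neg_Ioi]
  · simp_rw [mul_assoc]
    exact (integrableOn_pow_mul_exp_neg i).const_mul _

/-! ### `GL₁`, `GL₂` (3.6.3) and `RL₂` (3.6.9) -/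

/-- One-point Gauss–Laguerre: node `1`, weight `1`. [cite: DavisRabinowitz1984, Sect. 3.6 (3.6.3)] -/
def laguerreOne (f : ℝ → ℝ) : ℝ := f 1

/-- Two-point Gauss–Laguerre with node parameter `s` (`s² = 2`): nodes `2 ∓ s`, weights `(2 ± s)/4`.
[cite: DavisRabinowitz1984, Sect. 3.6 (3.6.3)] -/
def laguerreTwo (s : ℝ) (f : ℝ → ℝ) : ℝ := (2 + s) / 4 * f (2 - s) + (2 - s) / 4 * f (2 + s)

/-- Two-point Radau–Laguerre (3.6.9), `n = 2`: `½ f(0) + ½ f(2)`. [cite: DavisRabinowitz1984, Sect. 3.6 (3.6.9)] -/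
def radauLaguerreTwo (f : ℝ → ℝ) : ℝ := 1 / 2 * f 0 + 1 / 2 * f 2

/-- `GL₁` is exact on `𝒫₁`. [cite: DavisRabinowitz1984, Sect. 3.6 (3.6.3)] -/
theorem integral_eq_laguerreOne (p : ℝ[X]) (hp : p.natDegree ≤ 1) :
    ∫ x in Ioi (0 : ℝ), p.eval x * exp (-x) = laguerreOne fun x => p.eval x := by
  have hn : p.natDegree < 2 := by omega
  rw [integral_eval_mul_exp_neg_Ioi p hn, laguerreOne]
  simp only [eval_eq_sum_range' hn, Finset.sum_range_succ, Finset.sum_range_zero]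
  simp [Nat.factorial]

/-- `GL₁` on quadratics: `∫ - GL₁ = (1!)²/2! · p'' = (1/2) · 2 c₂`. [cite: DavisRabinowitz1984, Sect. 3.6 (3.6.3)] -/
theorem integral_sub_laguerreOne (p : ℝ[X]) (hp : p.natDegree ≤ 2) :
    (∫ x in Ioi (0 : ℝ), p.eval x * exp (-x)) - laguerreOne (fun x => p.eval x) = 1 / 2 * (2 * p.coeff 2) := by
  have hn : p.natDegree < 3 := by omega
  rw [integral_eval_mul_exp_neg_Ioi p hn, laguerreOne]
  simp only [eval_eq_sum_range' hn, Finset.sum_range_succ, Finset.sum_range_zero]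
  simp [Nat.factorial]
  ring

/-- `GL₂` is exact on `𝒫₃`. [cite: DavisRabinowitz1984, Sect. 3.6 (3.6.3)] -/
theorem integral_eq_laguerreTwo {s : ℝ} (hs : s ^ 2 = 2) (p : ℝ[X]) (hp : p.natDegree ≤ 3) :
    ∫ x in Ioi (0 : ℝ), p.eval x * exp (-x) = laguerreTwo s fun x => p.eval x := by
  have hn : p.natDegree < 4 := by omega
  rw [integral_eval_mul_exp_neg_Ioi p hn, laguerreTwo]
  simp only [eval_eq_sum_range' hn, Finset.sum_range_succ, Finset.sum_range_zero, Nat.factorial]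
  push_cast
  linear_combination (p.coeff 1 / 2 + p.coeff 2 + p.coeff 3 * (s ^ 2 + 2) / 2) * hs

/-- `GL₂` on quartics: `∫ - GL₂ = (2!)²/4! · p⁽⁴⁾ = (1/6) · 24 c₄`. [cite: DavisRabinowitz1984, Sect. 3.6 (3.6.3)] -/
theorem integral_sub_laguerreTwo {s : ℝ} (hs : s ^ 2 = 2) (p : ℝ[X]) (hp : p.natDegree ≤ 4) :
    (∫ x in Ioi (0 : ℝ), p.eval x * exp (-x)) - laguerreTwo s (fun x => p.eval x) =
      1 / 6 * (24 * p.coeff 4) := by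
  have hn : p.natDegree < 5 := by omega
  rw [integral_eval_mul_exp_neg_Ioi p hn, laguerreTwo]
  simp only [eval_eq_sum_range' hn, Finset.sum_range_succ, Finset.sum_range_zero, Nat.factorial]
  push_cast
  linear_combination (p.coeff 1 / 2 + p.coeff 2 + p.coeff 3 * (s ^ 2 + 2) / 2 + p.coeff 4 * (3 * s ^ 2 - 2)) * hs

/-- `RL₂` is exact on `𝒫₂`. [cite: DavisRabinowitz1984, Sect. 3.6 (3.6.9)] -/
theorem integral_eq_radauLaguerreTwo (p : ℝ[X]) (hp : p.natDegree ≤ 2) :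
    ∫ x in Ioi (0 : ℝ), p.eval x * exp (-x) = radauLaguerreTwo fun x => p.eval x := by
  have hn : p.natDegree < 3 := by omega
  rw [integral_eval_mul_exp_neg_Ioi p hn, radauLaguerreTwo]
  simp only [eval_eq_sum_range' hn, Finset.sum_range_succ, Finset.sum_range_zero, Nat.factorial]
  push_cast
  ring

/-- `RL₂` on cubics: `∫ - RL₂ = 1!2!/3! · p''' = (1/3) · 6 c₃`. [cite: DavisRabinowitz1984, Sect. 3.6 (3.6.9)] -/
theorem integral_sub_radauLaguerreTwo (p : ℝ[X]) (hp : p.natDegree ≤ 3) :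
    (∫ x in Ioi (0 : ℝ), p.eval x * exp (-x)) - radauLaguerreTwo (fun x => p.eval x) =
      1 / 3 * (6 * p.coeff 3) := by
  have hn : p.natDegree < 4 := by omega
  rw [integral_eval_mul_exp_neg_Ioi p hn, radauLaguerreTwo]
  simp only [eval_eq_sum_range' hn, Finset.sum_range_succ, Finset.sum_range_zero, Nat.factorial]
  push_cast
  ring

/-! ### Hermite moments `μ_i = ∫ x^i e^{-x²} dx` -/

/-- `x ↦ x^i e^{-x²}` is integrable on `ℝ`. [cite: DavisRabinowitz1984, Sect. 3.6 (3.6.11)] -/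
theorem integrable_pow_mul_exp_neg_sq (i : ℕ) : Integrable fun x : ℝ => x ^ i * exp (-x ^ 2) := by
  have h := integrable_rpow_mul_exp_neg_mul_sq (b := 1) one_pos (s := ((i : ℕ) : ℝ))
    (by have : (0 : ℝ) ≤ (i : ℝ) := by positivity
        linarith)
  refine h.congr (Filter.Eventually.of_forall fun x => ?_)
  simp only [Real.rpow_natCast, neg_mul, one_mul]

/-- Odd Hermite moments vanish: `∫ x^{2j+1} e^{-x²} dx = 0`. [cite: DavisRabinowitz1984, Sect. 3.6 (3.6.11)] -/
theorem integral_pow_odd_mul_exp_neg_sq (j : ℕ) : ∫ x : ℝ, x ^ (2 * j + 1) * exp (-x ^ 2) = 0 := by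
  have h := integral_neg_eq_self (fun x : ℝ => x ^ (2 * j + 1) * exp (-x ^ 2)) volume
  have h2 : (fun x : ℝ => (-x) ^ (2 * j + 1) * exp (-(-x) ^ 2)) =
      fun x => -(x ^ (2 * j + 1) * exp (-x ^ 2)) := by
    funext x; rw [Odd.neg_pow ⟨j, rfl⟩, neg_sq]; ring
  simp only [h2, integral_neg] at h
  linarith

/-- Even Hermite moments: `∫ x^{2j} e^{-x²} dx = Γ(j + ½)`. [cite: DavisRabinowitz1984, Sect. 3.6 (3.6.11)] -/
theorem integral_pow_even_mul_exp_neg_sq (j : ℕ) :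
    ∫ x : ℝ, x ^ (2 * j) * exp (-x ^ 2) = Gamma (j + 1 / 2) := by
  have h1 : (fun x : ℝ => x ^ (2 * j) * exp (-x ^ 2)) =
      fun x => (fun y : ℝ => y ^ (2 * j) * exp (-y ^ 2)) |x| := by
    funext x; simp only [Even.pow_abs ⟨j, two_mul j⟩, sq_abs]
  rw [h1, integral_comp_abs (f := fun y : ℝ => y ^ (2 * j) * exp (-y ^ 2))]
  have h2 := integral_rpow_mul_exp_neg_rpow (p := 2) (q := ((2 * j : ℕ) : ℝ)) two_pos
    (by have : (0 : ℝ) ≤ ((2 * j : ℕ) : ℝ) := by positivity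
        linarith)
  rw [setIntegral_congr_fun measurableSet_Ioi (fun x (_ : x ∈ Ioi (0 : ℝ)) => by
      show x ^ (2 * j) * exp (-x ^ 2) = x ^ ((2 * j : ℕ) : ℝ) * exp (-x ^ (2 : ℝ))
      rw [Real.rpow_natCast, show (2 : ℝ) = ((2 : ℕ) : ℝ) by norm_num, Real.rpow_natCast]), h2]
  have : (((2 * j : ℕ) : ℝ) + 1) / 2 = j + 1 / 2 := by push_cast; ring
  rw [this]; ring

/-- `Γ(½) = √π`, `Γ(3/2) = √π/2`, `Γ(5/2) = 3√π/4`, `Γ(7/2) = 15√π/8`.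
[cite: DavisRabinowitz1984, Sect. 3.6 (3.6.11)] -/
theorem Gamma_half_values : Gamma ((0 : ℕ) + 1 / 2) = √π ∧ Gamma ((1 : ℕ) + 1 / 2) = √π / 2 ∧
    Gamma ((2 : ℕ) + 1 / 2) = 3 * √π / 4 ∧ Gamma ((3 : ℕ) + 1 / 2) = 15 * √π / 8 := by
  have h0 : Gamma (1 / 2) = √π := Real.Gamma_one_half_eq
  have h1 : Gamma (1 / 2 + 1) = 1 / 2 * √π := by rw [Real.Gamma_add_one (by norm_num), h0]
  have h2 : Gamma (1 / 2 + 1 + 1) = (1 / 2 + 1) * (1 / 2 * √π) := by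
    rw [Real.Gamma_add_one (by norm_num), h1]
  have h3 : Gamma (1 / 2 + 1 + 1 + 1) = (1 / 2 + 1 + 1) * ((1 / 2 + 1) * (1 / 2 * √π)) := by
    rw [Real.Gamma_add_one (by norm_num), h2]
  refine ⟨?_, ?_, ?_, ?_⟩
  · simpa using h0
  · rw [show ((1 : ℕ) : ℝ) + 1 / 2 = 1 / 2 + 1 by norm_num, h1]; ring
  · rw [show ((2 : ℕ) : ℝ) + 1 / 2 = 1 / 2 + 1 + 1 by norm_num, h2]; ring
  · rw [show ((3 : ℕ) : ℝ) + 1 / 2 = 1 / 2 + 1 + 1 + 1 by norm_num, h3]; ring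

/-- The Hermite moments `μ₀,…,μ₆ = √π, 0, √π/2, 0, 3√π/4, 0, 15√π/8`.
[cite: DavisRabinowitz1984, Sect. 3.6 (3.6.11)] -/
theorem hermite_moments :
    (∫ x : ℝ, x ^ 0 * exp (-x ^ 2)) = √π ∧ (∫ x : ℝ, x ^ 1 * exp (-x ^ 2)) = 0 ∧
    (∫ x : ℝ, x ^ 2 * exp (-x ^ 2)) = √π / 2 ∧ (∫ x : ℝ, x ^ 3 * exp (-x ^ 2)) = 0 ∧
    (∫ x : ℝ, x ^ 4 * exp (-x ^ 2)) = 3 * √π / 4 ∧ (∫ x : ℝ, x ^ 5 * exp (-x ^ 2)) = 0 ∧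
    (∫ x : ℝ, x ^ 6 * exp (-x ^ 2)) = 15 * √π / 8 := by
  obtain ⟨g0, g1, g2, g3⟩ := Gamma_half_values
  refine ⟨?_, ?_, ?_, ?_, ?_, ?_, ?_⟩
  · rw [← g0, ← integral_pow_even_mul_exp_neg_sq 0]
  · exact integral_pow_odd_mul_exp_neg_sq 0
  · rw [← g1, ← integral_pow_even_mul_exp_neg_sq 1]
  · exact integral_pow_odd_mul_exp_neg_sq 1
  · rw [← g2, ← integral_pow_even_mul_exp_neg_sq 2]
  · exact integral_pow_odd_mul_exp_neg_sq 2
  · rw [← g3, ← integral_pow_even_mul_exp_neg_sq 3]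

/-- `∫ p(x) e^{-x²} dx = Σ_{i<n} c_i μ_i` for `deg p < n`. [cite: DavisRabinowitz1984, Sect. 3.6 (3.6.11)] -/
theorem integral_eval_mul_exp_neg_sq (p : ℝ[X]) {n : ℕ} (hn : p.natDegree < n) :
    ∫ x : ℝ, p.eval x * exp (-x ^ 2) = ∑ i ∈ range n, p.coeff i * ∫ x : ℝ, x ^ i * exp (-x ^ 2) := by
  simp_rw [eval_eq_sum_range' hn, Finset.sum_mul]
  rw [integral_finsetSum _ fun i _ => ?_]
  · refine Finset.sum_congr rfl fun i _ => ?_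
    simp_rw [mul_assoc]
    rw [integral_const_mul]
  · simp_rw [mul_assoc]
    exact (integrable_pow_mul_exp_neg_sq i).const_mul _

/-! ### `GH₂`, `GH₃` (3.6.11) -/

/-- Two-point Gauss–Hermite with node parameter `u` (`u² = 1/2`): weights `√π/2`.
[cite: DavisRabinowitz1984, Sect. 3.6 (3.6.11)] -/
def hermiteTwo (u : ℝ) (f : ℝ → ℝ) : ℝ := √π / 2 * (f (-u) + f u)

/-- Three-point Gauss–Hermite with node parameter `v` (`v² = 3/2`): weights `2√π/3`, `√π/6`, `√π/6`.
[cite: DavisRabinowitz1984, Sect. 3.6 (3.6.11)] -/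
def hermiteThree (v : ℝ) (f : ℝ → ℝ) : ℝ := 2 * √π / 3 * f 0 + √π / 6 * (f (-v) + f v)

/-- `GH₂` is exact on `𝒫₃`. [cite: DavisRabinowitz1984, Sect. 3.6 (3.6.11)] -/
theorem integral_eq_hermiteTwo {u : ℝ} (hu : u ^ 2 = 1 / 2) (p : ℝ[X]) (hp : p.natDegree ≤ 3) :
    ∫ x : ℝ, p.eval x * exp (-x ^ 2) = hermiteTwo u fun x => p.eval x := by
  have hn : p.natDegree < 4 := by omega
  obtain ⟨m0, m1, m2, m3, -, -, -⟩ := hermite_moments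
  rw [integral_eval_mul_exp_neg_sq p hn, hermiteTwo]
  simp only [eval_eq_sum_range' hn, Finset.sum_range_succ, Finset.sum_range_zero, m0, m1, m2, m3]
  linear_combination (-√π * p.coeff 2 - √π * p.coeff 3 * 0) * hu

/-- `GH₂` on quartics: `∫ - GH₂ = 2!√π/(2²·4!) · p⁽⁴⁾ = (√π/48) · 24 c₄`.
[cite: DavisRabinowitz1984, Sect. 3.6 (3.6.11)] -/
theorem integral_sub_hermiteTwo {u : ℝ} (hu : u ^ 2 = 1 / 2) (p : ℝ[X]) (hp : p.natDegree ≤ 4) :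
    (∫ x : ℝ, p.eval x * exp (-x ^ 2)) - hermiteTwo u (fun x => p.eval x) = √π / 48 * (24 * p.coeff 4) := by
  have hn : p.natDegree < 5 := by omega
  obtain ⟨m0, m1, m2, m3, m4, -, -⟩ := hermite_moments
  rw [integral_eval_mul_exp_neg_sq p hn, hermiteTwo]
  simp only [eval_eq_sum_range' hn, Finset.sum_range_succ, Finset.sum_range_zero, m0, m1, m2, m3, m4]
  linear_combination (-√π * p.coeff 2 - √π * p.coeff 4 * (u ^ 2 + 1 / 2)) * hu

/-- `GH₃` is exact on `𝒫₅`. [cite: DavisRabinowitz1984, Sect. 3.6 (3.6.11)] -/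
theorem integral_eq_hermiteThree {v : ℝ} (hv : v ^ 2 = 3 / 2) (p : ℝ[X]) (hp : p.natDegree ≤ 5) :
    ∫ x : ℝ, p.eval x * exp (-x ^ 2) = hermiteThree v fun x => p.eval x := by
  have hn : p.natDegree < 6 := by omega
  obtain ⟨m0, m1, m2, m3, m4, m5, -⟩ := hermite_moments
  rw [integral_eval_mul_exp_neg_sq p hn, hermiteThree]
  simp only [eval_eq_sum_range' hn, Finset.sum_range_succ, Finset.sum_range_zero, m0, m1, m2, m3, m4, m5]
  linear_combination (-(√π / 3) * p.coeff 2 - √π / 3 * p.coeff 4 * (v ^ 2 + 3 / 2)) * hv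

/-- `GH₃` on sextics: `∫ - GH₃ = 3!√π/(2³·6!) · p⁽⁶⁾ = (√π/960) · 720 c₆`.
[cite: DavisRabinowitz1984, Sect. 3.6 (3.6.11)] -/
theorem integral_sub_hermiteThree {v : ℝ} (hv : v ^ 2 = 3 / 2) (p : ℝ[X]) (hp : p.natDegree ≤ 6) :
    (∫ x : ℝ, p.eval x * exp (-x ^ 2)) - hermiteThree v (fun x => p.eval x) =
      √π / 960 * (720 * p.coeff 6) := by
  have hn : p.natDegree < 7 := by omega
  obtain ⟨m0, m1, m2, m3, m4, m5, m6⟩ := hermite_moments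
  rw [integral_eval_mul_exp_neg_sq p hn, hermiteThree]
  simp only [eval_eq_sum_range' hn, Finset.sum_range_succ, Finset.sum_range_zero, m0, m1, m2, m3, m4, m5,
    m6]
  linear_combination (-(√π / 3) * p.coeff 2 - √π / 3 * p.coeff 4 * (v ^ 2 + 3 / 2)
    - √π / 3 * p.coeff 6 * (v ^ 4 + 3 / 2 * v ^ 2 + 9 / 4)) * hv

/-- The error coefficients of (3.6.3), (3.6.9), (3.6.11) at the recorded orders:
`(1!)²/2! = 1/2`, `(2!)²/4! = 1/6`, `1!·2!/3! = 1/3`, `2!√π/(2²·4!) = √π/48`, `3!√π/(2³·6!) = √π/960`.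
[cite: DavisRabinowitz1984, Sect. 3.6 (3.6.3), (3.6.9), (3.6.11)] -/
theorem infinite_interval_error_coefficients :
    ((Nat.factorial 1 : ℝ) ^ 2 / Nat.factorial 2 = 1 / 2) ∧ ((Nat.factorial 2 : ℝ) ^ 2 / Nat.factorial 4 = 1 / 6) ∧
    ((Nat.factorial 1 : ℝ) * Nat.factorial 2 / Nat.factorial 3 = 1 / 3) ∧
    ((Nat.factorial 2 : ℝ) * √π / (2 ^ 2 * Nat.factorial 4) = √π / 48) ∧
    ((Nat.factorial 3 : ℝ) * √π / (2 ^ 3 * Nat.factorial 6) = √π / 960) := by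
  refine ⟨?_, ?_, ?_, ?_, ?_⟩ <;> norm_num [Nat.factorial] <;> ring

/-- The node parameters exist: `(√2)² = 2`, `(√2/2)² = 1/2`, `(√6/2)² = 3/2`.
[cite: DavisRabinowitz1984, Sect. 3.6 (3.6.3), (3.6.11)] -/
theorem infinite_interval_node_param_sq :
    Real.sqrt 2 ^ 2 = 2 ∧ (Real.sqrt 2 / 2) ^ 2 = 1 / 2 ∧ (Real.sqrt 6 / 2) ^ 2 = 3 / 2 := by
  refine ⟨Real.sq_sqrt (by norm_num), ?_, ?_⟩
  · rw [div_pow, Real.sq_sqrt (by norm_num)]; norm_num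
  · rw [div_pow, Real.sq_sqrt (by norm_num)]; norm_num

end

end Literature.Analysis.Quadrature
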